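import Summits.CriticalPhenomena.Ising3DConformalLimit.Theses.CurrentConnectionInvariance
import Literature.Probability.LatticeModels.ConformalCovariance
import HarnessLib

/-!
# Crux `LinkingParityCircles.SpinRatioMoebius` (stmt-CriticalPhenomena-4530), line `registered` —
# stub `stub_CCIRatioRotationOfLimit`: item 4842 `RatioRotationInvariance` from the telescoping limits of an
# `O(3)`-invariant family

If the weight-free telescoping ratios
`R^δ_n(z) = G^δ_n(z₁..z_n) · G^δ_2(z_{n+1}, z_{n+2}) / G^δ_{n+2}(z)` of the critical `ℤ³` Ising correlators converge,
for every even `n`, locally uniformly on the non-coincident locus to the telescoping quotient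
`p_n(z) = S_n(z₁..z_n) S_2(z_{n+1}, z_{n+2}) / S_{n+2}(z)` of a rotation (`O(3)`) invariant continuum family `S`,
then `R^δ_n(A ∘ x) − R^δ_n(x) → 0` as `δ → 0⁺` for every linear isometry `A` and every non-coincident `x`
(item stmt-CriticalPhenomena-4842, `CurrentConnectionInvariance.RatioRotationInvariance`).

Proof: `A ∘ x` is again non-coincident (`A` is injective), so the locally uniform convergence gives the two pointwise
limits `R^δ_n(A ∘ x) → p_n(A ∘ x)` and `R^δ_n(x) → p_n(x)`; by `O(3)` invariance of `S` at levels `n`, `2`, `n + 2`,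
`p_n(A ∘ x) = p_n(x)`, so the difference tends to `p_n(x) − p_n(x) = 0`.

References: P. Di Francesco, P. Mathieu, D. Sénéchal (Springer 1997) §4.3.1 (Euclidean invariance of correlators);
H. Duminil-Copin, ICM 2022, §8.1 (rotation invariance on `ℤ³` is open: this file only records the formal reduction).
-/

noncomputable section

namespace Summit.CriticalPhenomena.Ising3DConformalLimit.Cruxes.SpinRatioMoebius.Birth

open Literature.Probability.LatticeModels Filter Set
open scoped Topology

/-! ## §A Rotation invariance of the telescoping quotient of an `O(3)`-invariant family -/

/-- The telescoping quotient `S_n(z|_n) S_2(z_n, z_{n+1}) / S_{n+2}(z)` of an `O(3)`-invariant family `S` is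
`O(3)` invariant: `p_n(A ∘ x) = p_n(x)` for every linear isometry `A`. [folklore] -/
theorem telescopingQuotient_rotate {S : CorrFamily 3} (hrot : IsRotationInvariant S) (n : ℕ)
    (A : EuclideanSpace ℝ (Fin 3) ≃ₗᵢ[ℝ] EuclideanSpace ℝ (Fin 3)) (x : Fin (n + 2) → EuclideanSpace ℝ (Fin 3)) :
    S n (fun i => A (x (Fin.castAdd 2 i))) * S 2 (fun i => A (x (Fin.natAdd n i))) / S (n + 2) (fun i => A (x i)) =
      S n (fun i => x (Fin.castAdd 2 i)) * S 2 (fun i => x (Fin.natAdd n i)) / S (n + 2) x := by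
  rw [hrot n A (fun i => x (Fin.castAdd 2 i)), hrot 2 A (fun i => x (Fin.natAdd n i)), hrot (n + 2) A x]

/-- A linear isometry maps non-coincident configurations to non-coincident configurations. [folklore] -/
theorem rotate_mem_nonCoincident {n : ℕ} (A : EuclideanSpace ℝ (Fin 3) ≃ₗᵢ[ℝ] EuclideanSpace ℝ (Fin 3))
    {x : Fin n → EuclideanSpace ℝ (Fin 3)} (hx : x ∈ NonCoincident 3 n) :
    (fun i => A (x i)) ∈ NonCoincident 3 n :=
  (mem_nonCoincident _).2 (A.injective.comp ((mem_nonCoincident _).1 hx))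

/-! ## §B The stub -/

/-- **Stub `stub_CCIRatioRotationOfLimit` (item 4842 `RatioRotationInvariance` from the telescoping limits of an
`O(3)`-invariant family; provable now).** If the telescoping ratios `R^δ_n` converge locally uniformly on the locus to
the telescoping quotients of a rotation invariant family `S` (every even `n`), then `R^δ_n(A ∘ x) − R^δ_n(x) → 0` as
`δ → 0⁺` for every `A ∈ O(3)` and every non-coincident `x`. [folklore] -/
theorem stub_CCIRatioRotationOfLimit :
    ∀ (S : Literature.Probability.LatticeModels.CorrFamily 3), Literature.Probability.LatticeModels.IsRotationInvariant S → (∀ n : ℕ, Even n → TendstoLocallyUniformlyOn (fun (δ : ℝ) (z : Fin (n + 2) → EuclideanSpace ℝ (Fin 3)) => Literature.Probability.LatticeModels.rescaledCorrelator (Literature.Probability.LatticeModels.criticalCorr 3) 1 n δ (fun i => z (Fin.castAdd 2 i)) * Literature.Probability.LatticeModels.rescaledCorrelator (Literature.Probability.LatticeModels.criticalCorr 3) 1 2 δ (fun i => z (Fin.natAdd n i)) / Literature.Probability.LatticeModels.rescaledCorrelator (Literature.Probability.LatticeModels.criticalCorr 3) 1 (n + 2) δ z) (fun z => S n (fun i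 => z (Fin.castAdd 2 i)) * S 2 (fun i => z (Fin.natAdd n i)) / S (n + 2) z) (nhdsWithin 0 (Set.Ioi 0)) (Literature.Probability.LatticeModels.NonCoincident 3 (n + 2))) → Summit.CriticalPhenomena.Ising3DConformalLimit.Theses.CurrentConnectionInvariance.RatioRotationInvariance := by
  intro S hrot hT n hn _h2 A x hx
  -- the rotated configuration is again non-coincident
  have hAx : (fun i => A (x i)) ∈ NonCoincident 3 (n + 2) := rotate_mem_nonCoincident A hx
  -- the difference of the two pointwise limits (at `A ∘ x` and at `x`) of the locally uniform convergence
  have h := ((hT n hn).tendsto_at hAx).sub ((hT n hn).tendsto_at hx)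
  beta_reduce at h
  -- its limit value `p_n(A ∘ x) - p_n(x)` vanishes by `O(3)` invariance of `S`
  have key : S n (fun i => A (x (Fin.castAdd 2 i))) * S 2 (fun i => A (x (Fin.natAdd n i))) /
      S (n + 2) (fun i => A (x i)) -
      S n (fun i => x (Fin.castAdd 2 i)) * S 2 (fun i => x (Fin.natAdd n i)) / S (n + 2) x = 0 := by
    rw [telescopingQuotient_rotate hrot n A x, sub_self]
  rw [key] at h
  exact h

end Summit.CriticalPhenomena.Ising3DConformalLimit.Cruxes.SpinRatioMoebius.Birth

end
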